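import Summits.ValiantsHypothesis.ValiantsHypothesis.Theorems.BIPWhatWouldSuffice
import Literature.Computability.AlgebraicComplexity.IK2020OrbitClosureInvariantBound
import HarnessLib

/-!
# BIP corpus — «what would suffice», PART 4: the stabilizer-invariant hypothesis shape

Sorry-free Prop chain of the val-lit BIP corpus (parts 1–3: `BIPWhatWouldSuffice`,
`BIPWhatWouldSufficeTyped`, `BIPWhatWouldSufficeMult`), continued by ONE further hypothesis shape that
became typeable when the general GCT ceiling
`IK2020.orbitMultiplicity_toMatIdx_le_weylInvariantDim` landed (Ikenmeyer–Kandasamy 2020 §1/§9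
(9.3)–(9.4) = Bürgisser–Landsberg–Manivel–Weyman 2011 §4.1/(5.2.7) for EVERY form, proved in the tree
without Peter–Weyl): for a form `f` on the matrix space `MatIdx m`,
`mult_{λ*} k[Δ(f)] ≤ dim {λ}^{H_f}`, `{λ}` the Weyl module of `GL_{m²}` and `H_f` the stabilizer of `f`
(pulled back to `GL (Fin (m*m))` along `matIdxEquiv m`), rendered `IK2020.weylInvariantDim`.

HONEST FRAMING. Everything below is GLUE. The hypotheses are OPEN: no partition `λ` with
`dim {λ}^{H_{det_m}} <` (a per-side lower bound) is known for any `m ≥ 3`, and `ValiantsHypothesis`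
(`VP_ℂ ≠ VNP_ℂ`) is NOT proved anywhere in the tree. In PRINT this shape is the symmetric-Kronecker
route (BLMW Prop. 5.2.1: `dim {λ}^{H_{det_m}} = sk(λ, m×d)`, eq. (5.2.6) — a named fact
`BLMW2011_prop_5_2_1_invariants`, NOT used here); in the TREE the stabilizer-invariant dimension is the
PROVED ceiling and is only known to be `≤ sk` (`IK2020.weylInvariantDim_det_le_symKroneckerCoeffRect`),
so the hypotheses below are formally WEAKER than those of part 1 (a)/(e)/(f). The rung `(3, 4)` is
method validation at a known separation (`dc(per₃) = 7 > 4`), not complexity news.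

## Main results (elementary compositions of tree theorems)
* `multObstructionPer3Det4_of_weylInvariantDim_lt` (u): `dim {λ}^{H_{det₄}} < L ≤ mult_{λ*} ℂ[Δ(X₀₀ per₃)]`
  at some partition `λ` with `ℓ(λ) ≤ 16` closes the rung `MultObstructionPer3Det4`.
* `perDetMultiplicityObstruction_of_weylInvariantDim_lt` (u′): the same at general `(n, m)`, `n ≤ m`,
  giving `PerDetMultiplicityObstruction n m λ*`.
* `multObstructionsBeyondQuasiPoly_of_weylInvariantDimFamily` (v) and
  `valiantsHypothesis_of_weylInvariantDimFamily` (w): the family over the quasi-polynomial window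
  `2^((log₂ m + c)^c) ≤ n` gives `MultObstructionsBeyondQuasiPoly`, hence `ValiantsHypothesis` through
  the PROVED summit link `sufficesForVPneVNP_holds`.

## References
* P. Bürgisser, J. M. Landsberg, L. Manivel, J. Weyman, *An overview of mathematical issues arising in
  the geometric complexity theory approach to VP ≠ VNP*, SIAM J. Comput. 40 (2011) = arXiv:0907.2850v3,
  §4.1, §5.2 Prop. 5.2.1, (5.2.6)–(5.2.7).
* C. Ikenmeyer, U. Kandasamy, *Implementing geometric complexity theory: on the separation of orbit
  closures via symmetries*, STOC 2020 = arXiv:1911.03990, §1 (TeX L205–215, L247), §9 (9.3)–(9.4).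
* K. Mulmuley, M. Sohoni, *GCT II*, SIAM J. Comput. 38 (2008), §1 (the flip: obstructions from
  representation-theoretic data of the stabilizers).
-/

noncomputable section

namespace Summit.ValiantsHypothesis.BIPWhatWouldSufficeStab

open Literature.Computability.AlgebraicComplexity Literature.NumberTheory.DiophantineGeometry
open Summit.PneNP.GCT Summit.ValiantsHypothesis.BIPWhatWouldSuffice

/-! ### (u) the rung from a stabilizer-invariant dimension below a per-side lower bound -/

/-- **(u) Stabilizer-invariant form at `(3, 4)`**: if for some partition `λ` with at most `16` parts
the dimension of the `H_{det₄}`-invariants of the Weyl module `{λ}` of `GL₁₆`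
(`IK2020.weylInvariantDim`, stabilizer pulled back along `matIdxEquiv 4`) is strictly below a lower
bound `L` for the multiplicity of `λ*` in `ℂ[Δ(X₀₀ per₃)]`, the rung holds — by the PROVED ceiling
`mult_{λ*} ℂ[Δ(det₄)] ≤ dim {λ}^{H_{det₄}}` (`IK2020.orbitMultiplicity_toMatIdx_le_weylInvariantDim`,
BLMW (5.2.7) / IK (9.3)–(9.4)) and part 1 (c) `multObstructionPer3Det4_of_bounds`. OPEN hypothesis.
[cite: BLMW2011, §5.2 (5.2.7)] [cite: IkenmeyerKandasamy2019, §1 (TeX L205–215, L247)] -/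
theorem multObstructionPer3Det4_of_weylInvariantDim_lt {D : ℕ} (lam : Nat.Partition D)
    (hlam : lam.parts.card ≤ 4 * 4) (L : ℕ)
    (hU : IK2020.weylInvariantDim ℂ (4 * 4) lam
        ((linStabilizer (detFormLex ℂ 4)).comap (reindexGL (matIdxEquiv 4))) < L)
    (hL : L ≤ orbitMultiplicity ℂ (paddedPerFormLex ℂ 3 4) 4
        (Weight.dualOfPartition (4 * 4) lam).toMatIdx) :
    MultObstructionPer3Det4 :=
  multObstructionPer3Det4_of_bounds _ _ L
    (IK2020.orbitMultiplicity_toMatIdx_le_weylInvariantDim ℂ (detFormLex ℂ 4) 4 lam hlam) hL hU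

/-- **(u′) General `(n, m)`, `n ≤ m`** (per size `n`, det size `m`, the tree's
`PerDetMultiplicityObstruction n m χ` = `n ≤ m ∧ mult_χ k[Δ(det_m)] < mult_χ k[Δ(X₀₀^{m−n} per_n)]`):
`dim {λ}^{H_{det_m}} < L ≤ mult_{λ*} k[Δ(X₀₀^{m−n} per_n)]` gives the obstruction at `λ*`, in every
field of characteristic zero. OPEN hypothesis for every `n ≥ 3`.
[cite: BLMW2011, §5.2 (5.2.7)] [cite: IkenmeyerKandasamy2019, §9 eq. (9.3)–(9.4)] -/
theorem perDetMultiplicityObstruction_of_weylInvariantDim_lt {k : Type} [Field k] [CharZero k]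
    {n m D : ℕ} [NeZero m] (hnm : n ≤ m) (lam : Nat.Partition D) (hlam : lam.parts.card ≤ m * m)
    (L : ℕ)
    (hU : IK2020.weylInvariantDim k (m * m) lam
        ((linStabilizer (detFormLex k m)).comap (reindexGL (matIdxEquiv m))) < L)
    (hL : L ≤ orbitMultiplicity k (paddedPerFormLex k n m) m
        (Weight.dualOfPartition (m * m) lam).toMatIdx) :
    PerDetMultiplicityObstruction (k := k) n m (Weight.dualOfPartition (m * m) lam).toMatIdx :=
  perDetMultiplicityObstruction_iff.mpr
    ⟨hnm, lt_of_le_of_lt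
      (IK2020.orbitMultiplicity_toMatIdx_le_weylInvariantDim k (detFormLex k m) m lam hlam)
      (lt_of_lt_of_le hU hL)⟩

/-! ### (v)(w) the family over the quasi-polynomial window ⇒ the summit hypothesis ⇒ the summit -/

/-- **(v) Family version**: stabilizer-invariant obstructions `dim {λ}^{H_{det_n}} < L ≤ mult_{λ*}
ℂ[Δ(X₀₀^{n−m} per_m)]` at `(m, n)` with `m ≤ n` and `2^((log₂ m + c)^c) ≤ n`, for every `c`, give
`MultObstructionsBeyondQuasiPoly` (here `m` = per size, `n` = det size, the summit file's convention).
OPEN hypothesis — it is the multiplicity half of the Mulmuley–Sohoni programme in the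
BLMW/Ikenmeyer–Kandasamy stabilizer rendering; no instance with `m ≥ 3` is known.
[cite: BLMW2011, §5.2 Prop. 5.2.1] [cite: MulmuleySohoniGCT2SIAM2008, §1] -/
theorem multObstructionsBeyondQuasiPoly_of_weylInvariantDimFamily
    (h : ∀ c : ℕ, ∃ (m n : ℕ) (_ : NeZero n) (D : ℕ) (lam : Nat.Partition D) (L : ℕ),
      m ≤ n ∧ 2 ^ ((Nat.log 2 m + c) ^ c) ≤ n ∧ lam.parts.card ≤ n * n ∧
      IK2020.weylInvariantDim ℂ (n * n) lam
          ((linStabilizer (detFormLex ℂ n)).comap (reindexGL (matIdxEquiv n))) < L ∧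
      L ≤ orbitMultiplicity ℂ (paddedPerFormLex ℂ m n) n
          (Weight.dualOfPartition (n * n) lam).toMatIdx) :
    MultObstructionsBeyondQuasiPoly := by
  intro c
  obtain ⟨m, n, inst, D, lam, L, hmn, hle, hlam, hU, hL⟩ := h c
  exact ⟨m, n, inst, _, hle, perDetMultiplicityObstruction_of_weylInvariantDim_lt hmn lam hlam L hU hL⟩

/-- **(w) … and hence the summit constant** `ValiantsHypothesis` (`VP_ℂ ≠ VNP_ℂ`) through the PROVED
summit link `sufficesForVPneVNP_holds`. The hypothesis is OPEN and is the whole difficulty; nothing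
here is progress on it. [cite: MulmuleySohoniGCT2SIAM2008, §1] -/
theorem valiantsHypothesis_of_weylInvariantDimFamily
    (h : ∀ c : ℕ, ∃ (m n : ℕ) (_ : NeZero n) (D : ℕ) (lam : Nat.Partition D) (L : ℕ),
      m ≤ n ∧ 2 ^ ((Nat.log 2 m + c) ^ c) ≤ n ∧ lam.parts.card ≤ n * n ∧
      IK2020.weylInvariantDim ℂ (n * n) lam
          ((linStabilizer (detFormLex ℂ n)).comap (reindexGL (matIdxEquiv n))) < L ∧
      L ≤ orbitMultiplicity ℂ (paddedPerFormLex ℂ m n) n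
          (Weight.dualOfPartition (n * n) lam).toMatIdx) :
    ValiantsHypothesis :=
  sufficesForVPneVNP_holds (multObstructionsBeyondQuasiPoly_of_weylInvariantDimFamily h)

/-! ### Bookkeeping: the stabilizer form is formally weaker than the symmetric-Kronecker form -/

/-- **The `sk` form implies the stabilizer form** (so (u) subsumes part 1 (a) in the tree): a
symmetric-Kronecker obstruction `sk(λ, 4×d) < L ≤ mult_{λ*} ℂ[Δ(X₀₀ per₃)]` yields the stabilizer-form
hypothesis of (u) with the same `L`, by the PROVED inequality `dim {λ}^{H_{det₄}} ≤ sk(λ, 4×d)`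
(`IK2020.weylInvariantDim_det_le_symKroneckerCoeffRect`; BLMW print EQUALITY (5.2.6), a named fact not
used). [cite: BLMW2011, §5.2 Prop. 5.2.1 (5.2.6)] -/
theorem weylInvariantDim_lt_of_symKroneckerCoeffRect_lt {d : ℕ} (lam : Nat.Partition (4 * d))
    (hlam : lam.parts.card ≤ 4 * 4) (L : ℕ) (hsk : symKroneckerCoeffRect ℂ 4 d lam < L) :
    IK2020.weylInvariantDim ℂ (4 * 4) lam
        ((linStabilizer (detFormLex ℂ 4)).comap (reindexGL (matIdxEquiv 4))) < L :=
  lt_of_le_of_lt (IK2020.weylInvariantDim_det_le_symKroneckerCoeffRect ℂ lam hlam) hsk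

end Summit.ValiantsHypothesis.BIPWhatWouldSufficeStab

end
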